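import Summits.QuantumFields.YangMills.Theorems.UnitScaleTiltProp7CovariantOffKernel
import Summits.QuantumFields.YangMills.Theorems.UnitScaleTiltProp7SymAvgTwSymDefs
import HarnessLib

/-!
# Route `UnitScaleTilt`, crux «MinimiserStabilityRegPr» (stmt-QuantumFields-19200), stub `stub_existenceMinimalOrbit` (EX), positivity block behind `Lift` —
# pen (b) of ★p1 g22's `LOCATE-GAMMA-ROW-p1g22.md` §3 (★★OWNER g32 19:10:15Z «(b) (T) `Q_str ↔ QTwS` comparison → w7-19200»):
# **THE TRANSVERSE ROW (T) WITH THE AVERAGING OPERATOR OF RECORD `QTwS`, MODULO ONE DISPLAYED `ℓ²` COMPARISON ROW `hQcmp`**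

Cell `ym3-torus`, twin-width seat `ym-ust-19200-w7` (gen 10).  THEOREMS ONLY (0 `def`, 0 `sorry`); `--supports stmt-QuantumFields-19200 --as helper`, count-neutral.
YM₃ on T³ is ladder rung R3 — NOT d = 4, NOT infinite volume, NOT a mass gap, NOT Clay; nothing here claims the γ-row, a print row, the stub or the crux.

THE POINT.  The tree's (T) engine ✓`Prop7CovariantCoercivity.sum_normSq_le_curl_sq_add_divB_sq_add_avg_T3` ([Balaban1985BackgroundPropagators] Thm 3.11 in `L²` form off the
kernel) reads `ℓ⁻²Σ_b‖Y_b‖² ≤ 18(Σ‖curl_{U₀}Y‖² + Σ‖div_{U₀}Y‖²) + 16(ℓ^dℓ²)⁻¹ℓ⁻²·Σ_c‖T^{str}_{U₀}Y(c)‖²`, `ℓ = L^{K−n}`, with the CORNER-ANCHORED STRAIGHT TUBE SUM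
`T^{str}_{U₀}Y(c) = Σ_{r,t} Ad[U₀(treeWord r)·U₀(t·e_{c.dir})]·Y(x_r + t e_{c.dir}, c.dir)` as its averaging functional.  The γ-row of the EX face ([B9] (3.118)–(3.122)) is written with
the averaging operator OF RECORD `Q(U₀) := Prop7SymAvgTwSym.QTwS F n K h U₀` (the display's `Qk = η • toL2B ∘ QTwS ∘ toL2⁻¹`, ✓`Prop7SectET3HilbertLettersT3.QL2`).  ★p1 g22's LOCATE §1 (T):
«the remaining letter is the comparison `Q_str` ↔ `QTwS`».  This file is the ASSEMBLY half of that pen: it displays the comparison as ONE `ℓ²(coarse bonds)` row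
  `hQcmp : Σ_c‖T^{str}Y(c)‖² ≤ 2(ℓ^d)²·Σ_{c'}‖QTwS U₀ Y c'‖² + Cq·ε²·ℓ^{d+2}·Σ_b‖Y_b‖²`
(the currency in which the tree's true-linearisation machinery speaks: ✓`Prop7QSymEqTrueLinIter.QTwS_apply_eq_trueLinIter_sub_coarseGauge` (LEG), ✓`Prop7TrueLinIterStructure.trueLinIter_structure`,
✓`Prop7TrueLinIterDefect.sqrt_sum_normSq_reduced_sub_lineIter_le` (`ℓ²` defect of the reduced iterate against the iterated LINE means); at `U₀ = 1` the two functionals agree up to the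
normalisation `ℓ^d` by ✓`Prop7SymAvgTwSym.QTwS_one_apply` (J2), so `Cq·ε²` measures transports only) and proves that the row turns the engine into
  **(T)_Q: `(1 − 16·Cq·ε²)·ℓ⁻²Σ_b‖Y_b‖² ≤ 18(Σ‖curl_{U₀}Y‖² + Σ‖div_{U₀}Y‖²) + 32(ℓ^dℓ²)⁻¹ℓ⁻²(ℓ^d)²·Σ_{c'}‖QTwS U₀ Y c'‖²`** —
the transverse floor with `Q` of record, absolute constants, the `ε²`-loss ℓ-FREE (so any `Cq` is absorbed by the regularity window alone).  The supplier of `hQcmp` (pen (b1):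
LEG + STRUCTURE + DEFECT + the corner-comb∕centre-staircase transport comparison) is NOT here.
HONEST SCOPE.  Real arithmetic over the landed engine; the row `hQcmp` is DISPLAYED, asserted for nothing; no estimate of print is claimed.
References: T. Bałaban, CMP 99 (1985) 389–434 [Balaban1985BackgroundPropagators] (Thm 3.11 p.416, (3.14)–(3.15) p.393, (3.118)–(3.122) pp.419–420); CMP 98 (1985) 17–51
[Balaban1985Averaging] ((89)–(92) p.31, (125)–(127) p.36).
-/

set_option autoImplicit false

noncomputable section

open scoped BigOperators Matrix.Norms.L2Operator Matrix

namespace Summit.QuantumFields.YangMills.Theorems.Prop7TransverseRowOfQTwSTubeComparison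

open Literature.MathematicalPhysics.QuantumFieldTheory.Balaban1983to89
open Finset B1RG242Torus
open B7Prop1Explicit (treeWord)
open B7Eq78Linearization (conjR)
open B9Eq39Adjoint (curl divB)
open B10Eq27TorusAxialLog (holT unitsField toUField)
open B9TorusCalculus (torusT)
open T3ContinuumYM3Torus (T3Family)
open Summit.QuantumFields.YangMills.Theorems.Prop7CovariantCoercivity (sum_normSq_le_curl_sq_add_divB_sq_add_avg_T3)
open Summit.QuantumFields.YangMills.Theorems.Prop7SymAvgTwSym (QTwS)

/-- **(T)_Q — THE TRANSVERSE ROW WITH THE AVERAGING OPERATOR OF RECORD, MODULO THE `ℓ²` TUBE-COMPARISON ROW.**  For an `SU(2)` background with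
`dist1(U₀(∂p)) ≤ εℓ⁻²`, `216ε ≤ 1`, every `M₂(ℂ)`-valued bond field `Y`, and a displayed comparison row `hQcmp` between the engine's corner-anchored straight tube sums and
`QTwS U₀ Y` (squared, summed over coarse bonds, with an `ε²ℓ^{d+2}Σ‖Y‖²` transport loss):
`(1 − 16Cq·ε²)·ℓ⁻²Σ_b‖Y_b‖² ≤ 18(Σ‖curl_{U₀}Y‖²_HS + Σ‖div_{U₀}Y‖²_HS) + 32(ℓ^dℓ²)⁻¹ℓ⁻²(ℓ^d)²·Σ_{c'}‖QTwS U₀ Y c'‖²`.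
[cite: Balaban1985BackgroundPropagators, Thm 3.11 p.416, (3.118)-(3.122) pp.419-420] -/
theorem sum_normSq_le_curl_sq_add_divB_sq_add_QTwS_of_tubeRow (F : T3Family) (n K : ℕ) (h : n ≤ K)
    (U₀ : GaugeField (F.P K) 0 (Matrix.specialUnitaryGroup (Fin 2) ℂ)) {ε : ℝ} (hε : 0 ≤ ε) (hε1 : 216 * ε ≤ 1)
    (hU : ∀ p : Plaq (F.P K) 0, dist1 (GaugeField.plaqHol U₀ p) ≤ ε * (((F.L : ℝ) ^ (K - n)) ^ 2)⁻¹)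
    (Y : PBond (F.P K) 0 → Matrix (Fin 2) (Fin 2) ℂ)
    (Cq : ℝ)
    -- THE DISPLAYED ROW (pen (b1)): corner-anchored straight tube sums vs the averaging operator of record, in `ℓ²(coarse bonds)`, transport loss `Cq·ε²·ℓ^{d+2}·Σ‖Y‖²`
    (hQcmp : ∑ c : PBond (F.P K) (K - n), ‖∑ r : Fin (F.P K).d → Fin ((F.P K).L ^ (K - n)), ∑ t ∈ range ((F.P K).L ^ (K - n)),
        conjR (holT (unitsField (toUField U₀)) (Site.fibreSite 0 (K - n) c.src fun _ => ⟨0, pow_pos (F.P K).L_pos (K - n)⟩)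
              (treeWord fun ν => ((r ν : ℕ) : ℤ))
            * holT (unitsField (toUField U₀)) (Site.fibreSite 0 (K - n) c.src r) (List.replicate t (c.dir, true)))
          (Y ⟨(fun z : Site (F.P K) 0 => z.shift c.dir)^[t] (Site.fibreSite 0 (K - n) c.src r), c.dir⟩)‖ ^ 2
      ≤ 2 * (((F.L : ℝ) ^ (K - n)) ^ (F.P K).d) ^ 2 * ∑ c' : PBond (F.P n) 0, ‖QTwS F n K h U₀ Y c'‖ ^ 2
        + Cq * ε ^ 2 * (((F.L : ℝ) ^ (K - n)) ^ (F.P K).d * ((F.L : ℝ) ^ (K - n)) ^ 2) * ∑ b : PBond (F.P K) 0, ‖Y b‖ ^ 2) :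
    (1 - 16 * Cq * ε ^ 2) * ((((F.L : ℝ) ^ (K - n)) ^ 2)⁻¹ * ∑ b : PBond (F.P K) 0, ‖Y b‖ ^ 2)
      ≤ 18 * (∑ x : Site (F.P K) 0, ∑ μ : Fin (F.P K).d, ∑ ν : Fin (F.P K).d,
            (if μ < ν then ∑ j : Fin 2, ∑ k : Fin 2,
              ‖(curl (torusT (F.P K) 0) (fun κ z => unitsField (toUField U₀) ⟨z, κ⟩) (fun κ z => Y ⟨z, κ⟩) μ ν x) j k‖ ^ 2 else 0)
          + ∑ x : Site (F.P K) 0, ∑ j : Fin 2, ∑ k : Fin 2,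
              ‖(divB (torusT (F.P K) 0) (fun κ z => unitsField (toUField U₀) ⟨z, κ⟩) (fun κ z => Y ⟨z, κ⟩) x) j k‖ ^ 2)
        + 32 * (((((F.L : ℝ) ^ (K - n)) ^ (F.P K).d) * ((F.L : ℝ) ^ (K - n)) ^ 2)⁻¹ * (((F.L : ℝ) ^ (K - n)) ^ 2)⁻¹)
          * (((F.L : ℝ) ^ (K - n)) ^ (F.P K).d) ^ 2 * ∑ c' : PBond (F.P n) 0, ‖QTwS F n K h U₀ Y c'‖ ^ 2 := by
  have hE := sum_normSq_le_curl_sq_add_divB_sq_add_avg_T3 F n K U₀ hε hε1 hU Y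
  -- letters: ℓ² =: l2 > 0, ℓ^d =: ld > 0, the sums S (fine), CD (curl + div), T (tube), Q (QTwS)
  set l2 : ℝ := ((F.L : ℝ) ^ (K - n)) ^ 2 with hl2
  set ld : ℝ := ((F.L : ℝ) ^ (K - n)) ^ (F.P K).d with hld
  set S : ℝ := ∑ b : PBond (F.P K) 0, ‖Y b‖ ^ 2 with hS
  set Q : ℝ := ∑ c' : PBond (F.P n) 0, ‖QTwS F n K h U₀ Y c'‖ ^ 2 with hQ
  set T : ℝ := ∑ c : PBond (F.P K) (K - n), ‖∑ r : Fin (F.P K).d → Fin ((F.P K).L ^ (K - n)), ∑ t ∈ range ((F.P K).L ^ (K - n)),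
        conjR (holT (unitsField (toUField U₀)) (Site.fibreSite 0 (K - n) c.src fun _ => ⟨0, pow_pos (F.P K).L_pos (K - n)⟩)
              (treeWord fun ν => ((r ν : ℕ) : ℤ))
            * holT (unitsField (toUField U₀)) (Site.fibreSite 0 (K - n) c.src r) (List.replicate t (c.dir, true)))
          (Y ⟨(fun z : Site (F.P K) 0 => z.shift c.dir)^[t] (Site.fibreSite 0 (K - n) c.src r), c.dir⟩)‖ ^ 2 with hT
  have hLpos : (0 : ℝ) < (F.L : ℝ) ^ (K - n) := by
    have : (0 : ℝ) < F.L := by have := F.hL.2; exact_mod_cast (by omega : 0 < F.L)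
    positivity
  have hl2pos : 0 < l2 := by rw [hl2]; positivity
  have hldpos : 0 < ld := by rw [hld]; positivity
  have hSnn : 0 ≤ S := by rw [hS]; positivity
  have hQnn : 0 ≤ Q := by rw [hQ]; positivity
  -- the weight identity: (ld·l2)⁻¹·l2⁻¹·(ld·l2) = l2⁻¹
  have hw : ((ld * l2)⁻¹ * l2⁻¹) * (Cq * ε ^ 2 * (ld * l2) * S) = Cq * ε ^ 2 * (l2⁻¹ * S) := by
    field_simp
  have hwQ : ((ld * l2)⁻¹ * l2⁻¹) * (2 * ld ^ 2 * Q) = 2 * (((ld * l2)⁻¹ * l2⁻¹) * ld ^ 2 * Q) := by ring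
  have hwnn : 0 ≤ (ld * l2)⁻¹ * l2⁻¹ := by positivity
  -- the engine's averaging term is monotone in T: substitute the row
  have h16 : 16 * ((ld * l2)⁻¹ * l2⁻¹) * T ≤ 16 * ((ld * l2)⁻¹ * l2⁻¹) * (2 * ld ^ 2 * Q + Cq * ε ^ 2 * (ld * l2) * S) :=
    mul_le_mul_of_nonneg_left hQcmp (by positivity)
  have h16' : 16 * ((ld * l2)⁻¹ * l2⁻¹) * (2 * ld ^ 2 * Q + Cq * ε ^ 2 * (ld * l2) * S)
      = 32 * ((ld * l2)⁻¹ * l2⁻¹) * ld ^ 2 * Q + 16 * Cq * ε ^ 2 * (l2⁻¹ * S) := by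
    have := hw
    calc 16 * ((ld * l2)⁻¹ * l2⁻¹) * (2 * ld ^ 2 * Q + Cq * ε ^ 2 * (ld * l2) * S)
        = 16 * (((ld * l2)⁻¹ * l2⁻¹) * (2 * ld ^ 2 * Q)) + 16 * (((ld * l2)⁻¹ * l2⁻¹) * (Cq * ε ^ 2 * (ld * l2) * S)) := by ring
      _ = 32 * ((ld * l2)⁻¹ * l2⁻¹) * ld ^ 2 * Q + 16 * Cq * ε ^ 2 * (l2⁻¹ * S) := by rw [hw]; ring
  linarith [hE, h16, h16']

/-- ★★ **THE SAME DOOR WITH A FREE COMPARISON CONSTANT `CT`** (v2 of the row: the located (b1) supplier — LEG ⊕ STRUCTURE ⊕ coarse-gauge identity ⊕ DEFECT ⊕ the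
tower-vs-corner transport comparison, read on all carriers through ✓`Prop7TubeComparisonRowOfSkewRow` — delivers `Σ_c‖T^{str}Y(c)‖² ≤ CT·(ℓ^d)²·Σ‖QTwS Y‖² + Cq·ε²·ℓ^dℓ²·Σ‖Y‖²`
with `CT = 4` (two Cauchy–Schwarz halvings: the error split and the Frobenius∕operator-norm conversion), not `2`; this version takes any `CT`):
`(1 − 16·Cq·ε²)·ℓ⁻²Σ_b‖Y_b‖² ≤ 18(curl² + div²) + 16·CT·(ℓ^dℓ²)⁻¹ℓ⁻²·(ℓ^d)²·Σ_{c'}‖QTwS U₀ Y c'‖²`.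
[cite: Balaban1985BackgroundPropagators, Thm 3.11 p.416, (3.118)-(3.122) pp.419-420; Balaban1984PropagatorsI, (1.18) p.20] -/
theorem sum_normSq_le_curl_sq_add_divB_sq_add_QTwS_of_tubeRowC (F : T3Family) (n K : ℕ) (h : n ≤ K)
    (U₀ : GaugeField (F.P K) 0 (Matrix.specialUnitaryGroup (Fin 2) ℂ)) {ε : ℝ} (hε : 0 ≤ ε) (hε1 : 216 * ε ≤ 1)
    (hU : ∀ p : Plaq (F.P K) 0, dist1 (GaugeField.plaqHol U₀ p) ≤ ε * (((F.L : ℝ) ^ (K - n)) ^ 2)⁻¹)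
    (Y : PBond (F.P K) 0 → Matrix (Fin 2) (Fin 2) ℂ)
    (CT Cq : ℝ)
    -- THE DISPLAYED ROW (pen (b1)), free comparison constant `CT`
    (hQcmp : ∑ c : PBond (F.P K) (K - n), ‖∑ r : Fin (F.P K).d → Fin ((F.P K).L ^ (K - n)), ∑ t ∈ range ((F.P K).L ^ (K - n)),
        conjR (holT (unitsField (toUField U₀)) (Site.fibreSite 0 (K - n) c.src fun _ => ⟨0, pow_pos (F.P K).L_pos (K - n)⟩)
              (treeWord fun ν => ((r ν : ℕ) : ℤ))
            * holT (unitsField (toUField U₀)) (Site.fibreSite 0 (K - n) c.src r) (List.replicate t (c.dir, true)))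
          (Y ⟨(fun z : Site (F.P K) 0 => z.shift c.dir)^[t] (Site.fibreSite 0 (K - n) c.src r), c.dir⟩)‖ ^ 2
      ≤ CT * (((F.L : ℝ) ^ (K - n)) ^ (F.P K).d) ^ 2 * ∑ c' : PBond (F.P n) 0, ‖QTwS F n K h U₀ Y c'‖ ^ 2
        + Cq * ε ^ 2 * (((F.L : ℝ) ^ (K - n)) ^ (F.P K).d * ((F.L : ℝ) ^ (K - n)) ^ 2) * ∑ b : PBond (F.P K) 0, ‖Y b‖ ^ 2) :
    (1 - 16 * Cq * ε ^ 2) * ((((F.L : ℝ) ^ (K - n)) ^ 2)⁻¹ * ∑ b : PBond (F.P K) 0, ‖Y b‖ ^ 2)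
      ≤ 18 * (∑ x : Site (F.P K) 0, ∑ μ : Fin (F.P K).d, ∑ ν : Fin (F.P K).d,
            (if μ < ν then ∑ j : Fin 2, ∑ k : Fin 2,
              ‖(curl (torusT (F.P K) 0) (fun κ z => unitsField (toUField U₀) ⟨z, κ⟩) (fun κ z => Y ⟨z, κ⟩) μ ν x) j k‖ ^ 2 else 0)
          + ∑ x : Site (F.P K) 0, ∑ j : Fin 2, ∑ k : Fin 2,
              ‖(divB (torusT (F.P K) 0) (fun κ z => unitsField (toUField U₀) ⟨z, κ⟩) (fun κ z => Y ⟨z, κ⟩) x) j k‖ ^ 2)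
        + 16 * CT * (((((F.L : ℝ) ^ (K - n)) ^ (F.P K).d) * ((F.L : ℝ) ^ (K - n)) ^ 2)⁻¹ * (((F.L : ℝ) ^ (K - n)) ^ 2)⁻¹)
          * (((F.L : ℝ) ^ (K - n)) ^ (F.P K).d) ^ 2 * ∑ c' : PBond (F.P n) 0, ‖QTwS F n K h U₀ Y c'‖ ^ 2 := by
  have hE := sum_normSq_le_curl_sq_add_divB_sq_add_avg_T3 F n K U₀ hε hε1 hU Y
  set l2 : ℝ := ((F.L : ℝ) ^ (K - n)) ^ 2 with hl2
  set ld : ℝ := ((F.L : ℝ) ^ (K - n)) ^ (F.P K).d with hld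
  set S : ℝ := ∑ b : PBond (F.P K) 0, ‖Y b‖ ^ 2 with hS
  set Q : ℝ := ∑ c' : PBond (F.P n) 0, ‖QTwS F n K h U₀ Y c'‖ ^ 2 with hQ
  set T : ℝ := ∑ c : PBond (F.P K) (K - n), ‖∑ r : Fin (F.P K).d → Fin ((F.P K).L ^ (K - n)), ∑ t ∈ range ((F.P K).L ^ (K - n)),
        conjR (holT (unitsField (toUField U₀)) (Site.fibreSite 0 (K - n) c.src fun _ => ⟨0, pow_pos (F.P K).L_pos (K - n)⟩)
              (treeWord fun ν => ((r ν : ℕ) : ℤ))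
            * holT (unitsField (toUField U₀)) (Site.fibreSite 0 (K - n) c.src r) (List.replicate t (c.dir, true)))
          (Y ⟨(fun z : Site (F.P K) 0 => z.shift c.dir)^[t] (Site.fibreSite 0 (K - n) c.src r), c.dir⟩)‖ ^ 2 with hT
  have hLpos : (0 : ℝ) < (F.L : ℝ) ^ (K - n) := by
    have : (0 : ℝ) < F.L := by have := F.hL.2; exact_mod_cast (by omega : 0 < F.L)
    positivity
  have hl2pos : 0 < l2 := by rw [hl2]; positivity
  have hldpos : 0 < ld := by rw [hld]; positivity
  -- the weight identity: (ld·l2)⁻¹·l2⁻¹·(ld·l2) = l2⁻¹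
  have hw : ((ld * l2)⁻¹ * l2⁻¹) * (Cq * ε ^ 2 * (ld * l2) * S) = Cq * ε ^ 2 * (l2⁻¹ * S) := by
    field_simp
  -- the engine's averaging term is monotone in T: substitute the row
  have h16 : 16 * ((ld * l2)⁻¹ * l2⁻¹) * T ≤ 16 * ((ld * l2)⁻¹ * l2⁻¹) * (CT * ld ^ 2 * Q + Cq * ε ^ 2 * (ld * l2) * S) :=
    mul_le_mul_of_nonneg_left hQcmp (by positivity)
  have h16' : 16 * ((ld * l2)⁻¹ * l2⁻¹) * (CT * ld ^ 2 * Q + Cq * ε ^ 2 * (ld * l2) * S)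
      = 16 * CT * ((ld * l2)⁻¹ * l2⁻¹) * ld ^ 2 * Q + 16 * Cq * ε ^ 2 * (l2⁻¹ * S) := by
    calc 16 * ((ld * l2)⁻¹ * l2⁻¹) * (CT * ld ^ 2 * Q + Cq * ε ^ 2 * (ld * l2) * S)
        = 16 * CT * (((ld * l2)⁻¹ * l2⁻¹) * ld ^ 2 * Q) + 16 * (((ld * l2)⁻¹ * l2⁻¹) * (Cq * ε ^ 2 * (ld * l2) * S)) := by ring
      _ = 16 * CT * ((ld * l2)⁻¹ * l2⁻¹) * ld ^ 2 * Q + 16 * Cq * ε ^ 2 * (l2⁻¹ * S) := by rw [hw]; ring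
  linarith [hE, h16, h16']

end Summit.QuantumFields.YangMills.Theorems.Prop7TransverseRowOfQTwSTubeComparison

end
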